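/-
Copyright (c) 2026. All rights reserved.
Released under Apache 2.0 license as described in the file LICENSE.
-/
import Summits.AtomisticToContinuum.Crystallization.Theorems.ChartedZeroExcessLayeredLatticeLiouvilleVS

/-!
# ChartedZeroExcessLayeredLatticeLiouville — part VT «SlopeBlock»: the gap flux of an antisymmetric bond field, the SLOPE BLOCK of the affine
  mode field, and the residual of a mode field = chain residual + slope residual (decomp-a2c-lens-2, g58; helper of
  stmt-AtomisticToContinuum-26636, leaf (LD′) `ModalLipschitzZ`; brick (3) MODE EXTRACTION, typed target `ModeExtractionShape` of g57)

A MODE FIELD is `modeField g cf γ α = Σ_j γ_j • g j + cf α` (in-plane affine slope `g : Fin 2 → E3`, layer profile `cf : ℤ → E3`).  Its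
`ϱ`-truncated residual at `(γ, α)` is in-plane translation invariant and equals, at `(0, m)`, the CHAIN RESIDUAL `Σ_β chainK (0,m) β (cf β − cf m)`
(VI/VO) plus the SLOPE RESIDUAL `Σ_β slopeK (0,m) β g` of the new SLOPE BLOCK
`slopeK ϱ a b w X β g = Σᶠ_{γ'} nearK X (γ', β) (Σ_j (γ'_j − X.1 j) • g j)` (`truncResidual_modeField_eq`).  The slope block is a finite sum
(`slopeK_eq_sum`), in-plane translation invariant (`slopeK_translate`), ANTISYMMETRIC under `α ↔ β` (`slopeK_swap`, from `nearK_comm`: the bond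
from `(γ', β)` back to `(0, α)` carries the opposite slope vector) and banded (`slopeK_eq_zero_of_lt_natAbs`).  For any antisymmetric bond field
`f` the GAP FLUX `gapFlux T f m = Σ_{α ≤ m < β} f α β` satisfies the divergence identity `gapFlux m − gapFlux (m−1) = Σ_β f m β`
(`gapFlux_sub_gapFlux`, the proof of VO `chainFlux_sub_chainFlux` verbatim) and reduces to the band box (`gapFlux_eq_box`); hence a mode field is
`ϱ`-harmonic everywhere as soon as its total column flux `columnFlux` (chain flux + slope flux through the gap above `m`) is independent of `m`
(`isTruncHarmonicZ_modeField_of`, used in part VV).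
-/

namespace Summit.AtomisticToContinuum.Crystallization.Theorems.ChartedZeroExcessLayeredLatticeLiouville

open Summit.AtomisticToContinuum.Crystallization.Theorems.ChartedPlanarOrderRigidityDoor (E3)
open Finset
open scoped InnerProductSpace RealInnerProductSpace BigOperators

noncomputable section SlopeBlock

variable {c : ℝ} {a b : E3} {w : ℤ → E3}

/-! ### VT.1  The gap flux of an antisymmetric bond field -/

/-- the GAP FLUX of a bond field `f : ℤ → ℤ → E3` through the gap above layer `m`, carried by the finset `T`: `Σ_{α ∈ T, α ≤ m} Σ_{β ∈ T, m < β} f α β`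
(VO `chainFlux T cf m` is the gap flux of the chain bond field `f α β = chainK (0,α) β (cf β − cf α)`). -/
def gapFlux (T : Finset ℤ) (f : ℤ → ℤ → E3) (m : ℤ) : E3 :=
  ∑ α ∈ T with α ≤ m, ∑ β ∈ T with m < β, f α β

/-- an antisymmetric bond field vanishes on the diagonal. [formal bookkeeping] -/
theorem bond_self_eq_zero {f : ℤ → ℤ → E3} (hf : ∀ α β, f β α = -f α β) (m : ℤ) : f m m = 0 := by
  have h2 : (2 : ℝ) • f m m = 0 := by
    rw [two_smul]
    exact eq_neg_iff_add_eq_zero.mp (hf m m)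
  exact (smul_eq_zero.mp h2).resolve_left two_ne_zero

/-- ★ DIVERGENCE IDENTITY for an antisymmetric bond field: `gapFlux T f m − gapFlux T f (m − 1) = Σ_{β ∈ T} f m β` for `m ∈ T` (the proof of
VO `chainFlux_sub_chainFlux`, with the antisymmetry `f β α = −f α β` in place of the chain block symmetry). [this file, g58] -/
theorem gapFlux_sub_gapFlux {f : ℤ → ℤ → E3} (hf : ∀ α β, f β α = -f α β) {T : Finset ℤ} {m : ℤ} (hm : m ∈ T) :
    gapFlux T f m - gapFlux T f (m - 1) = ∑ β ∈ T, f m β := by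
  have hm1 : m ∉ T.filter fun α => α < m := fun h => lt_irrefl m (Finset.mem_filter.mp h).2
  have hm2 : m ∉ T.filter fun β => m < β := fun h => lt_irrefl m (Finset.mem_filter.mp h).2
  have e1 : gapFlux T f m = (∑ β ∈ T with m < β, f m β) + ∑ α ∈ T with α < m, ∑ β ∈ T with m < β, f α β := by
    unfold gapFlux
    rw [filter_le_eq_insert hm, sum_insert hm1]
  have e2 : gapFlux T f (m - 1) = (∑ α ∈ T with α < m, f α m) + ∑ α ∈ T with α < m, ∑ β ∈ T with m < β, f α β := by
    unfold gapFlux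
    rw [filter_le_pred_eq, filter_pred_lt_eq_insert hm, ← sum_add_distrib]
    exact sum_congr rfl fun α _ => sum_insert hm2
  have e3 : ∑ β ∈ T, f m β = (∑ β ∈ T with β < m, f m β) + ∑ β ∈ T with m < β, f m β :=
    sum_eq_sum_lt_add_sum_gt (fun β => f m β) (bond_self_eq_zero hf m)
  have e4 : ∑ β ∈ T with β < m, f m β = -∑ α ∈ T with α < m, f α m := by
    rw [← sum_neg_distrib]
    exact sum_congr rfl fun α _ => hf α m
  rw [e1, e2, e3, e4, add_sub_add_right_eq_sub]
  abel

/-- ★ BAND BOX: if the bond field vanishes beyond band width `r` (`f α β = 0` for `|β − α| > r`), then for every carrier containing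
`[m − r, m + 1 + r]` the gap flux is the double sum over the box `α ∈ [m − r, m]`, `β ∈ [m + 1, m + 1 + r]` (the proof of VP `chainFlux_eq_box`).
[this file, g58] -/
theorem gapFlux_eq_box {f : ℤ → ℤ → E3} {r : ℕ} (hfar : ∀ α β : ℤ, r < (β - α).natAbs → f α β = 0) {T : Finset ℤ} {m : ℤ}
    (hT : Icc (m - r) (m + 1 + r) ⊆ T) :
    gapFlux T f m = ∑ α ∈ Icc (m - r) m, ∑ β ∈ Icc (m + 1) (m + 1 + r), f α β := by
  unfold gapFlux
  have hout : ∑ α ∈ Icc (m - (r : ℤ)) m, ∑ β ∈ T with m < β, f α β = ∑ α ∈ T with α ≤ m, ∑ β ∈ T with m < β, f α β := by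
    refine sum_subset (fun α hα => ?_) (fun α hα hα' => ?_)
    · rw [mem_Icc] at hα
      exact mem_filter.mpr ⟨hT (mem_Icc.mpr ⟨hα.1, by omega⟩), hα.2⟩
    · have hαm := (mem_filter.mp hα).2
      rw [mem_Icc, not_and_or, not_le, not_le] at hα'
      refine sum_eq_zero fun β hβ => hfar α β ?_
      have hβm := (mem_filter.mp hβ).2
      omega
  rw [← hout]
  refine sum_congr rfl fun α hα => ?_
  rw [mem_Icc] at hα
  symm
  refine sum_subset (fun β hβ => ?_) (fun β hβ hβ' => ?_)
  · rw [mem_Icc] at hβ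
    exact mem_filter.mpr ⟨hT (mem_Icc.mpr ⟨by omega, hβ.2⟩), by omega⟩
  · have hβm := (mem_filter.mp hβ).2
    rw [mem_Icc, not_and_or, not_le, not_le] at hβ'
    refine hfar α β ?_
    omega

/-! ### VT.2  The slope block -/

/-- the SLOPE BLOCK of the affine mode: the truncated force at `X` exerted through the bonds to layer `β` by the in-plane affine field of slope `g`,
measured from `X`: `Σᶠ_{γ'} nearK X (γ', β) (Σ_j (γ'_j − X.1 j) • g j)` (typed in the g57 sketch of (3); verbatim). -/
def slopeK (ϱ : ℝ) (a b : E3) (w : ℤ → E3) (X : Cell 2 × ℤ) (β : ℤ) (g : Fin 2 → E3) : E3 :=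
  ∑ᶠ γ' : Cell 2, nearK ϱ a b w X (γ', β) (∑ j, (((γ' j - X.1 j : ℤ)) : ℝ) • g j)

/-- the slope block as a FINITE sum over the `β`-fibre of any finset containing the `ϱ`-near sites of `X` (as VI `chainK_eq_sum`). [formal bookkeeping] -/
theorem slopeK_eq_sum {ϱ : ℝ} {X : Cell 2 × ℤ} {N : Finset (Cell 2 × ℤ)}
    (hN : ∀ Y : Cell 2 × ℤ, ‖lsite a b w Y.1 Y.2 - lsite a b w X.1 X.2‖ ≤ ϱ → Y ∈ N) (β : ℤ) (g : Fin 2 → E3) :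
    slopeK ϱ a b w X β g = ∑ Y ∈ N with Y.2 = β, nearK ϱ a b w X Y (∑ j, (((Y.1 j - X.1 j : ℤ)) : ℝ) • g j) := by
  have hsupp : (Function.support fun γ' : Cell 2 => nearK ϱ a b w X (γ', β) (∑ j, (((γ' j - X.1 j : ℤ)) : ℝ) • g j)) ⊆
      ((N.filter fun Y => Y.2 = β).image Prod.fst : Finset (Cell 2)) := by
    intro γ' hγ'
    rw [Function.mem_support] at hγ'
    have hle : ‖lsite a b w γ' β - lsite a b w X.1 X.2‖ ≤ ϱ := not_lt.mp fun h => hγ' (nearK_eq_zero_of_lt (X := X) (Y := (γ', β)) h _)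
    rw [coe_image, coe_filter]
    exact ⟨(γ', β), ⟨hN (γ', β) hle, rfl⟩, rfl⟩
  have hinj : Set.InjOn Prod.fst ((N.filter fun Y => Y.2 = β : Finset (Cell 2 × ℤ)) : Set (Cell 2 × ℤ)) := by
    intro Y hY Y' hY' h
    rw [coe_filter] at hY hY'
    exact Prod.ext h (hY.2.trans hY'.2.symm)
  rw [slopeK, finsum_eq_sum_of_support_subset _ hsupp, sum_image hinj]
  refine sum_congr rfl fun Y hY => ?_
  have hY2 : Y.2 = β := (mem_filter.mp hY).2
  rw [← hY2]

/-- the slope block `slopeK X β g` vanishes when layer `β` is farther than `ϱ` from `X` (co-Lipschitz bound of the layer difference). [formal bookkeeping] -/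
theorem slopeK_eq_zero_of_far (hc : 0 < c) (hL : IsLayeredCrystal c a b w) {ϱ : ℝ} {X : Cell 2 × ℤ} {β : ℤ}
    (h : ϱ < c * |(((β - X.2 : ℤ)) : ℝ)|) (g : Fin 2 → E3) : slopeK ϱ a b w X β g = 0 := by
  unfold slopeK
  refine (finsum_congr fun γ' => ?_).trans finsum_zero
  refine nearK_eq_zero_of_lt (X := X) (Y := (γ', β)) (h.trans_le ?_) _
  calc c * |(((β - X.2 : ℤ)) : ℝ)| ≤ c * dist X (γ', β) := mul_le_mul_of_nonneg_left (abs_snd_sub_le_dist X (γ', β)) hc.le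
    _ = c * dist (γ', β) X := by rw [dist_comm]
    _ ≤ ‖lsite a b w γ' β - lsite a b w X.1 X.2‖ := hL (γ', β) X

/-- the slope block vanishes beyond the band: `slopeK (0,α) β g = 0` whenever `⌊ϱ/c⌋₊ < |β − α|`. [formal bookkeeping] -/
theorem slopeK_eq_zero_of_lt_natAbs (hc : 0 < c) (hL : IsLayeredCrystal c a b w) {ϱ : ℝ} {α β : ℤ}
    (h : ⌊ϱ / c⌋₊ < (β - α).natAbs) (g : Fin 2 → E3) : slopeK ϱ a b w ((0 : Cell 2), α) β g = 0 :=
  slopeK_eq_zero_of_far hc hL (X := ((0 : Cell 2), α)) (not_le.mp fun hle => (not_le.mpr h) (natAbs_le_floor_of_band hc hle)) g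

/-- the slope block `slopeK X β g` vanishes for every layer `β` outside the layer window of `X`. [formal bookkeeping] -/
theorem slopeK_eq_zero_of_not_mem_layerWindow (hc : 0 < c) (hL : IsLayeredCrystal c a b w) {ϱ : ℝ} {X : Cell 2 × ℤ} {β : ℤ}
    (hβ : β ∉ layerWindow hc hL ϱ X) (g : Fin 2 → E3) : slopeK ϱ a b w X β g = 0 := by
  have hN : ∀ Y : Cell 2 × ℤ, ‖lsite a b w Y.1 Y.2 - lsite a b w X.1 X.2‖ ≤ ϱ → Y ∈ (finite_near_lsite hc hL X ϱ).toFinset :=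
    fun _ hY => (finite_near_lsite hc hL X ϱ).mem_toFinset.mpr hY
  rw [slopeK_eq_sum hN]
  refine sum_eq_zero fun Y hY => ?_
  exfalso
  refine hβ ?_
  rw [layerWindow, Finset.mem_image]
  exact ⟨Y, (Finset.mem_filter.mp hY).1, (Finset.mem_filter.mp hY).2⟩

/-- the layer window of `(0, m)` lies in the band `[m − ⌊ϱ/c⌋₊, m + ⌊ϱ/c⌋₊]` (co-Lipschitz bound of the layer difference). [formal bookkeeping] -/
theorem layerWindow_subset_Icc (hc : 0 < c) (hL : IsLayeredCrystal c a b w) (ϱ : ℝ) (m : ℤ) :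
    layerWindow hc hL ϱ ((0 : Cell 2), m) ⊆ Icc (m - ⌊ϱ / c⌋₊) (m + ⌊ϱ / c⌋₊) := by
  intro β hβ
  rw [layerWindow, Finset.mem_image] at hβ
  obtain ⟨Y, hY, rfl⟩ := hβ
  have hYn : ‖lsite a b w Y.1 Y.2 - lsite a b w ((0 : Cell 2), m).1 ((0 : Cell 2), m).2‖ ≤ ϱ :=
    (finite_near_lsite hc hL _ ϱ).mem_toFinset.mp hY
  have hband : c * |(((Y.2 - m : ℤ)) : ℝ)| ≤ ϱ := by
    refine le_trans ?_ hYn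
    calc c * |(((Y.2 - m : ℤ)) : ℝ)| ≤ c * dist ((0 : Cell 2), m) Y :=
          mul_le_mul_of_nonneg_left (abs_snd_sub_le_dist ((0 : Cell 2), m) Y) hc.le
      _ = c * dist Y ((0 : Cell 2), m) := by rw [dist_comm]
      _ ≤ _ := hL Y ((0 : Cell 2), m)
  have h := natAbs_le_floor_of_band hc hband
  rw [mem_Icc]
  omega

/-- in-plane shift of a finitely supported sum over the cells. [formal bookkeeping] -/
theorem finsum_cell_shift (γ : Cell 2) (F : Cell 2 → E3) : ∑ᶠ δ, F δ = ∑ᶠ δ, F (δ + γ) :=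
  (finsum_comp_equiv (Equiv.addRight γ) (f := F)).symm

/-- in-plane reflection of a finitely supported sum over the cells. [formal bookkeeping] -/
theorem finsum_cell_neg (F : Cell 2 → E3) : ∑ᶠ δ, F δ = ∑ᶠ δ, F (-δ) :=
  (finsum_comp_equiv (Equiv.neg (Cell 2)) (f := F)).symm

/-- ★ IN-PLANE TRANSLATION INVARIANCE of the slope block: `slopeK (γ, α) β g = slopeK (0, α) β g` (`nearK_translate`; the slope vector is measured
from the base cell). [this file, g58] -/
theorem slopeK_translate (ϱ : ℝ) (a b : E3) (w : ℤ → E3) (γ : Cell 2) (α β : ℤ) (g : Fin 2 → E3) :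
    slopeK ϱ a b w (γ, α) β g = slopeK ϱ a b w ((0 : Cell 2), α) β g := by
  unfold slopeK
  refine (finsum_cell_shift γ _).trans (finsum_congr fun δ => ?_)
  rw [nearK_translate]
  simp

/-- ★ ANTISYMMETRY of the slope block under `α ↔ β`: `slopeK (0, β) α g = −slopeK (0, α) β g` (bond reversal `nearK_comm`, in-plane reflection and
translation: the reversed bond carries the opposite slope vector). [this file, g58] -/
theorem slopeK_swap (ϱ : ℝ) (a b : E3) (w : ℤ → E3) (α β : ℤ) (g : Fin 2 → E3) :
    slopeK ϱ a b w ((0 : Cell 2), β) α g = -slopeK ϱ a b w ((0 : Cell 2), α) β g := by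
  unfold slopeK
  rw [← finsum_neg_distrib]
  refine (finsum_cell_neg _).trans (finsum_congr fun δ => ?_)
  rw [nearK_comm ϱ a b w (-δ, α) ((0 : Cell 2), β), nearK_translate, ← nearK_neg]
  simp

/-- the diagonal slope block vanishes: `slopeK (0, α) α g = 0`. [formal bookkeeping] -/
theorem slopeK_self (ϱ : ℝ) (a b : E3) (w : ℤ → E3) (α : ℤ) (g : Fin 2 → E3) : slopeK ϱ a b w ((0 : Cell 2), α) α g = 0 :=
  bond_self_eq_zero (f := fun α β => slopeK ϱ a b w ((0 : Cell 2), α) β g) (fun α β => slopeK_swap ϱ a b w α β g) α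

/-! ### VT.3  Mode fields: residual = chain residual + slope residual -/

/-- the AFFINE field of in-plane slope `g`: `γ ↦ Σ_j γ_j • g j` (layer independent). -/
def affField (g : Fin 2 → E3) : Cell 2 → ℤ → E3 := fun γ _ => ∑ j, ((γ j : ℤ) : ℝ) • g j

/-- the MODE FIELD of slope `g` and layer profile `cf`: `(γ, α) ↦ Σ_j γ_j • g j + cf α` (typed in the g57 sketch of (3); verbatim). -/
def modeField (g : Fin 2 → E3) (cf : ℤ → E3) : Cell 2 → ℤ → E3 := fun γ α => (∑ j, ((γ j : ℤ) : ℝ) • g j) + cf α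

/-- a mode field is the affine field plus the layer-only field. [formal bookkeeping] -/
theorem modeField_eq_add (g : Fin 2 → E3) (cf : ℤ → E3) : modeField g cf = affField g + fun _ α => cf α := rfl

/-- the truncated residual of the affine field is the SLOPE RESIDUAL over the `β`-fibres of any finset containing the near sites. [this file, g58] -/
theorem truncResidual_affField_eq_sum {ϱ : ℝ} {X : Cell 2 × ℤ} {N : Finset (Cell 2 × ℤ)}
    (hN : ∀ Y : Cell 2 × ℤ, ‖lsite a b w Y.1 Y.2 - lsite a b w X.1 X.2‖ ≤ ϱ → Y ∈ N) (g : Fin 2 → E3) :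
    truncResidual ϱ a b w (affField g) X = ∑ β ∈ N.image Prod.snd, slopeK ϱ a b w X β g := by
  rw [truncResidual_eq_sum_nearK hN]
  have hsum : ∀ Y : Cell 2 × ℤ, affField g Y.1 Y.2 - affField g X.1 X.2 = ∑ j, (((Y.1 j - X.1 j : ℤ)) : ℝ) • g j := fun Y => by
    simp only [affField, ← Finset.sum_sub_distrib, ← sub_smul, Int.cast_sub]
  simp only [hsum, slopeK_eq_sum hN]
  exact (sum_fiberwise_of_maps_to (s := N) (t := N.image Prod.snd) (g := Prod.snd) (fun _ hY => mem_image_of_mem _ hY) _).symm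

/-- the truncated residual of the affine field at `X` is the slope residual over the layer window of `X`. [formal bookkeeping] -/
theorem truncResidual_affField_eq (hc : 0 < c) (hL : IsLayeredCrystal c a b w) (ϱ : ℝ) (g : Fin 2 → E3) (X : Cell 2 × ℤ) :
    truncResidual ϱ a b w (affField g) X = ∑ β ∈ layerWindow hc hL ϱ X, slopeK ϱ a b w X β g :=
  truncResidual_affField_eq_sum (fun _ hY => (finite_near_lsite hc hL X ϱ).mem_toFinset.mpr hY) g

/-- the slope residual over any carrier containing the layer window. [formal bookkeeping] -/
theorem sum_slopeK_eq_truncResidual (hc : 0 < c) (hL : IsLayeredCrystal c a b w) (ϱ : ℝ) (g : Fin 2 → E3) {T : Finset ℤ} {m : ℤ}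
    (hT : layerWindow hc hL ϱ ((0 : Cell 2), m) ⊆ T) :
    ∑ β ∈ T, slopeK ϱ a b w ((0 : Cell 2), m) β g = truncResidual ϱ a b w (affField g) ((0 : Cell 2), m) := by
  rw [truncResidual_affField_eq hc hL, ← sum_subset hT fun β _ hβ => slopeK_eq_zero_of_not_mem_layerWindow hc hL hβ _]

/-- ★ RESIDUAL OF A MODE FIELD = CHAIN RESIDUAL + SLOPE RESIDUAL over any carrier `T` containing the layer window of `(0, m)`. [this file, g58] -/
theorem truncResidual_modeField_eq (hc : 0 < c) (hL : IsLayeredCrystal c a b w) (ϱ : ℝ) (g : Fin 2 → E3) (cf : ℤ → E3)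
    {T : Finset ℤ} {m : ℤ} (hT : layerWindow hc hL ϱ ((0 : Cell 2), m) ⊆ T) :
    truncResidual ϱ a b w (modeField g cf) ((0 : Cell 2), m) =
      (∑ β ∈ T, chainK ϱ a b w ((0 : Cell 2), m) β (cf β - cf m)) + ∑ β ∈ T, slopeK ϱ a b w ((0 : Cell 2), m) β g := by
  rw [modeField_eq_add, truncResidual_add hc hL, ← sum_chainK_eq_truncResidual hc hL ϱ cf hT,
    ← sum_slopeK_eq_truncResidual hc hL ϱ g hT, add_comm]

/-- ★ IN-PLANE TRANSLATION INVARIANCE of the residual of a mode field. [this file, g58] -/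
theorem truncResidual_modeField_translate (hc : 0 < c) (hL : IsLayeredCrystal c a b w) (ϱ : ℝ) (g : Fin 2 → E3) (cf : ℤ → E3)
    (γ : Cell 2) (α : ℤ) :
    truncResidual ϱ a b w (modeField g cf) (γ, α) = truncResidual ϱ a b w (modeField g cf) ((0 : Cell 2), α) := by
  rw [modeField_eq_add, truncResidual_add hc hL, truncResidual_add hc hL, truncResidual_layerField_translate hc hL,
    truncResidual_affField_eq hc hL, truncResidual_affField_eq hc hL, layerWindow_translate hc hL]
  congr 1
  exact sum_congr rfl fun β _ => slopeK_translate ϱ a b w γ α β g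

/-- ★ HARMONICITY CRITERION for mode fields: if the residual vanishes at every base site `(0, m)`, the mode field is `ϱ`-truncated-harmonic
everywhere (translation invariance + UU `isTruncHarmonicZ_of_truncResidual_eq_zero`). [this file, g58] -/
theorem isTruncHarmonicZ_modeField_of (hc : 0 < c) (hL : IsLayeredCrystal c a b w) (ϱ : ℝ) (g : Fin 2 → E3) (cf : ℤ → E3)
    (h : ∀ m : ℤ, truncResidual ϱ a b w (modeField g cf) ((0 : Cell 2), m) = 0) :
    IsTruncHarmonicZ ϱ a b w (modeField g cf) Set.univ :=
  isTruncHarmonicZ_of_truncResidual_eq_zero hc hL fun X _ => by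
    obtain ⟨γ, α⟩ := X
    rw [truncResidual_modeField_translate hc hL]
    exact h α

/-! ### VT.4  The column flux of a mode field -/

/-- the COLUMN FLUX of the mode field `(g, cf)` through the gap above layer `m`: chain flux plus slope flux over the band box of width `r`
(typed in the g57 sketch of (3); verbatim). -/
def columnFlux (ϱ : ℝ) (a b : E3) (w : ℤ → E3) (r : ℕ) (g : Fin 2 → E3) (cf : ℤ → E3) (m : ℤ) : E3 :=
  ∑ α ∈ Icc (m - r) m, ∑ β ∈ Icc (m + 1) (m + 1 + r),
    (chainK ϱ a b w ((0 : Cell 2), α) β (cf β - cf α) + slopeK ϱ a b w ((0 : Cell 2), α) β g)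

/-- the SLOPE FLUX through the gap above layer `m` over the band box of width `r` (the `cf`-independent part of the column flux). -/
def boxSlope (ϱ : ℝ) (a b : E3) (w : ℤ → E3) (r : ℕ) (g : Fin 2 → E3) (m : ℤ) : E3 :=
  ∑ α ∈ Icc (m - r) m, ∑ β ∈ Icc (m + 1) (m + 1 + r), slopeK ϱ a b w ((0 : Cell 2), α) β g

/-- column flux = box chain flux + box slope flux. [formal bookkeeping] -/
theorem columnFlux_eq (ϱ : ℝ) (a b : E3) (w : ℤ → E3) (r : ℕ) (g : Fin 2 → E3) (cf : ℤ → E3) (m : ℤ) :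
    columnFlux ϱ a b w r g cf m =
      (∑ α ∈ Icc (m - r) m, ∑ β ∈ Icc (m + 1) (m + 1 + r), chainK ϱ a b w ((0 : Cell 2), α) β (cf β - cf α)) + boxSlope ϱ a b w r g m := by
  unfold columnFlux boxSlope
  rw [← sum_add_distrib]
  exact sum_congr rfl fun α _ => sum_add_distrib

/-- the slope gap flux over any carrier containing the band box is the box slope flux (`gapFlux_eq_box` + the band of `slopeK`). [formal bookkeeping] -/
theorem gapFlux_slopeK_eq_boxSlope (hc : 0 < c) (hL : IsLayeredCrystal c a b w) {ϱ : ℝ} (g : Fin 2 → E3) {T : Finset ℤ} {m : ℤ}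
    (hT : Icc (m - ⌊ϱ / c⌋₊) (m + 1 + ⌊ϱ / c⌋₊) ⊆ T) :
    gapFlux T (fun α β => slopeK ϱ a b w ((0 : Cell 2), α) β g) m = boxSlope ϱ a b w ⌊ϱ / c⌋₊ g m :=
  gapFlux_eq_box (fun _ _ h => slopeK_eq_zero_of_lt_natAbs hc hL h g) hT

/-- ★ SLOPE DIVERGENCE: for every carrier `T ∋ m` containing both band boxes `[m − 1 − r, m + 1 + r]`,
`Σ_{β ∈ T} slopeK (0,m) β g = boxSlope r g m − boxSlope r g (m − 1)`. [this file, g58] -/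
theorem sum_slopeK_eq_boxSlope_sub (hc : 0 < c) (hL : IsLayeredCrystal c a b w) {ϱ : ℝ} (g : Fin 2 → E3) {T : Finset ℤ} {m : ℤ}
    (hm : m ∈ T) (hT : Icc (m - 1 - ⌊ϱ / c⌋₊) (m + 1 + ⌊ϱ / c⌋₊) ⊆ T) :
    ∑ β ∈ T, slopeK ϱ a b w ((0 : Cell 2), m) β g = boxSlope ϱ a b w ⌊ϱ / c⌋₊ g m - boxSlope ϱ a b w ⌊ϱ / c⌋₊ g (m - 1) := by
  have h1 : Icc (m - ⌊ϱ / c⌋₊) (m + 1 + ⌊ϱ / c⌋₊) ⊆ T := fun k hk => hT (by rw [mem_Icc] at hk ⊢; omega)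
  have h2 : Icc (m - 1 - ⌊ϱ / c⌋₊) (m - 1 + 1 + ⌊ϱ / c⌋₊) ⊆ T := fun k hk => hT (by rw [mem_Icc] at hk ⊢; omega)
  rw [← gapFlux_slopeK_eq_boxSlope hc hL g h1, ← gapFlux_slopeK_eq_boxSlope hc hL g h2]
  exact (gapFlux_sub_gapFlux (fun α β => slopeK_swap ϱ a b w α β g) hm).symm

/-- ★ CHAIN DIVERGENCE in box form: for every carrier `T ∋ m` containing `[m − 1 − r, m + 1 + r]`,
`Σ_{β ∈ T} chainK (0,m) β (cf β − cf m) = chainFlux T cf m − chainFlux T cf (m − 1)` (VO). [formal bookkeeping] -/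
theorem sum_chainK_eq_chainFlux_sub (hc : 0 < c) (hL : IsLayeredCrystal c a b w) (ϱ : ℝ) (cf : ℤ → E3) {T : Finset ℤ} {m : ℤ}
    (hm : m ∈ T) :
    ∑ β ∈ T, chainK ϱ a b w ((0 : Cell 2), m) β (cf β - cf m) = chainFlux ϱ a b w T cf m - chainFlux ϱ a b w T cf (m - 1) :=
  (chainFlux_sub_chainFlux hc hL ϱ cf hm).symm

/-- ★★ FLUX CONSERVATION ⟹ ZERO RESIDUAL: if the column flux of the mode field `(g, cf)` (band width `⌊ϱ/c⌋₊`) is the same through every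
gap, its residual vanishes at every base site (chain divergence + slope divergence over the carrier `[m − 1 − r, m + 1 + r]`). [this file, g58] -/
theorem truncResidual_modeField_eq_zero_of_columnFlux (hc : 0 < c) (hL : IsLayeredCrystal c a b w) (ϱ : ℝ) (g : Fin 2 → E3)
    (cf : ℤ → E3) {F : E3} (hF : ∀ m : ℤ, columnFlux ϱ a b w ⌊ϱ / c⌋₊ g cf m = F) (m : ℤ) :
    truncResidual ϱ a b w (modeField g cf) ((0 : Cell 2), m) = 0 := by
  have key : ∀ {T : Finset ℤ}, Icc (m - 1 - ⌊ϱ / c⌋₊) (m + 1 + ⌊ϱ / c⌋₊) ⊆ T →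
      truncResidual ϱ a b w (modeField g cf) ((0 : Cell 2), m) = 0 := by
    intro T hT
    have hm : m ∈ T := hT (by rw [mem_Icc]; omega)
    have hW : layerWindow hc hL ϱ ((0 : Cell 2), m) ⊆ T :=
      (layerWindow_subset_Icc hc hL ϱ m).trans fun k hk => hT (by rw [mem_Icc] at hk ⊢; omega)
    have h1 : Icc (m - ⌊ϱ / c⌋₊) (m + 1 + ⌊ϱ / c⌋₊) ⊆ T := fun k hk => hT (by rw [mem_Icc] at hk ⊢; omega)
    have h2 : Icc (m - 1 - ⌊ϱ / c⌋₊) (m - 1 + 1 + ⌊ϱ / c⌋₊) ⊆ T := fun k hk => hT (by rw [mem_Icc] at hk ⊢; omega)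
    have e1 : chainFlux ϱ a b w T cf m + boxSlope ϱ a b w ⌊ϱ / c⌋₊ g m = F := by
      rw [← hF m, columnFlux_eq, chainFlux_eq_box hc hL cf h1]
    have e2 : chainFlux ϱ a b w T cf (m - 1) + boxSlope ϱ a b w ⌊ϱ / c⌋₊ g (m - 1) = F := by
      rw [← hF (m - 1), columnFlux_eq, chainFlux_eq_box hc hL cf h2]
    rw [truncResidual_modeField_eq hc hL ϱ g cf hW, sum_chainK_eq_chainFlux_sub hc hL ϱ cf hm, sum_slopeK_eq_boxSlope_sub hc hL g hm hT]
    calc chainFlux ϱ a b w T cf m - chainFlux ϱ a b w T cf (m - 1) + (boxSlope ϱ a b w ⌊ϱ / c⌋₊ g m - boxSlope ϱ a b w ⌊ϱ / c⌋₊ g (m - 1))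
        = (chainFlux ϱ a b w T cf m + boxSlope ϱ a b w ⌊ϱ / c⌋₊ g m)
          - (chainFlux ϱ a b w T cf (m - 1) + boxSlope ϱ a b w ⌊ϱ / c⌋₊ g (m - 1)) := by abel
      _ = 0 := by rw [e1, e2, sub_self]
  exact key Subset.rfl

/-- ★★ FLUX CONSERVATION ⟹ HARMONIC: if the column flux of the mode field `(g, cf)` (band width `⌊ϱ/c⌋₊`) is the same through every gap, the mode
field is `ϱ`-truncated-harmonic everywhere. [this file, g58] -/
theorem isTruncHarmonicZ_modeField_of_columnFlux (hc : 0 < c) (hL : IsLayeredCrystal c a b w) (ϱ : ℝ) (g : Fin 2 → E3) (cf : ℤ → E3)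
    {F : E3} (hF : ∀ m : ℤ, columnFlux ϱ a b w ⌊ϱ / c⌋₊ g cf m = F) :
    IsTruncHarmonicZ ϱ a b w (modeField g cf) Set.univ :=
  isTruncHarmonicZ_modeField_of hc hL ϱ g cf (truncResidual_modeField_eq_zero_of_columnFlux hc hL ϱ g cf hF)

end SlopeBlock

end Summit.AtomisticToContinuum.Crystallization.Theorems.ChartedZeroExcessLayeredLatticeLiouville
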